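import Summits.QuantumFields.BalabanUV.T4Continuum.Support.AveragingDeficitTorusChart

/-!
# AveragingDeficitChartCalculus (T⁴ programme, node NE3, row NE3-R2, gen 3) — MULTI-DIMENSIONAL SMOOTHNESS OF
# BAŁABAN'S AVERAGE (42) IN THE EXPONENTIAL CHART OVER THE FINITE TORUS, AND ITS DIFFERENTIAL
# `D(log V̄⁻¹·avg)(0) = pushDir` BY NAME (file 2/3 of R0 = Fermat on the composite-constraint manifold)

HONEST FRAMING (cell `pub-balaban`, T4-DAG PAGE 1; unit `b2b-balaban-t4-ne3r2-p1` = owner of BINDER-OWNERS row NE3-R2,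
gen 3).  The cell's T4 target is the finite-torus continuum limit of the unit-scale averaged loop expectations — NOT
infinite volume, NO mass gap, NOT Clay, NOT summit progress.  R0 (Fermat on the manifold cut out by a constraint imposed
THROUGH the average (42)) needs (42) as a STRICTLY DIFFERENTIABLE map of the whole configuration; the tree's §8 of
`T4AveragingDeficitWall` differentiates along ONE-parameter families `V e^{sψ}` only.  THIS FILE supplies the
multi-dimensional calculus on the chart of `AveragingDeficitTorusChart`, all [folklore], 0 sorry:
§4 `ContDiffAt ℝ m` (every `m`) of every stage of (42) in the chart parameter `ψ ∈ TDir d n N` — `contDiff_chartDir_apply`,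
`contDiffAt_val_chart`(`_inv`), `contDiffAt_val_stepHol_chart`, **`contDiffAt_val_hol_chart`** (transport (9) along any
word), `contDiffAt_val_Wcx_chart`, `contDiffAt_mlog_Wcx_chart` (inside the ball of (21), tree `analyticAt_mlog`),
`contDiffAt_Xavg_chart`, **`contDiffAt_val_bavg_chart`**(`_inv`) (the average (42)), `contDiffAt_fineAction_chart` (B11 (5)
through the tree's continuous linear `nReTrL`) — the §8 chain of `T4AveragingDeficitWall` line by line with `ContDiffAt`
for `DifferentiableAt` (`NormedSpace.exp_analytic`, `contDiffAt_ringInverse`, products);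
§5 the COORDINATES OF THE AVERAGE on the coarse torus bonds, `coord P L M V ψ = log((cavg V)(b)⁻¹·(cavg (chart ψ))(b))`
(`cavg L U (y,κ) = Ū(⟨Ly, Ly+Le_κ⟩)` = the average read on the coarse unit lattice; `relLog`), `coord_zero`,
`contDiffAt_coord`; `mlog_one`, **`hasFDerivAt_mlog_one`** (`D log(1) = id`, from the tree's `exp_mlog` and Mathlib's
`hasFDerivAt_exp_zero`); `hasDerivAt_comp_smul` (directional derivatives from the Fréchet derivative); and
**`fderiv_coord_apply : D coord(0) ψ (r,κ) = pushDir L V (chartDir ψ) (L·r, κ)`** — gen 2's push-forward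
`AveragingDeficitResidualPairing.pushDir` BY NAME, via `AveragingDeficitSideDeriv.hasDerivAt_val_bavg_vary`;
`hasDerivAt_fineAction_chartDir` (the derivative of the fine action along `vary V (chartDir ψ)` is the Fréchet
derivative of the chart action applied to `ψ`).  File 3/3 (`AveragingDeficitFermat`) turns these into R0.
NE3 ITSELF IS NOT PROVED: NE3(A) ⇐ ML ∧ R0 ∧ β ∧ γ (record `t4/T4-EST-NE3-P2.md` §0 (e)); NE3 stays COND-free.
CITATION HEADER: no printed sentence is a hypothesis; the manuscripts under audit are not cited for any disputed step;
context: T. Bałaban, Commun. Math. Phys. **98** (1985) 17–51 [Balaban1985Averaging] ((9) p. 18, (21) p. 21, (42) p. 23);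
**102** (1985) 277–309 [Balaban1985Variational] ((5) p. 278, (75)–(77) p. 289).
PLACEMENT: `Summits/QuantumFields/BalabanUV/` (human rule 2026-08-19).  Record: HOME `t4/T4-EST-NE3-R2.md` v0.4.
-/

set_option autoImplicit false

open scoped BigOperators Matrix Matrix.Norms.L2Operator Topology
open NormedSpace Finset Filter

namespace Summit.QuantumFields.BalabanUV.T4Continuum.AveragingDeficitChartCalculus

open Literature.MathematicalPhysics.QuantumFieldTheory.Balaban1983to89
open B7Prop1Explicit B7Prop2Explicit MatrixLog UnitaryModel
open T4AveragingDeficitWall hiding Site Plane Plaq Bond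
open T4AveragingDeficitWallBoundary (IsPeriodicCfg)
open T4AveragingDeficitNonAbelian (hol_add_period)
open AveragingDeficitTransport AveragingDeficitPlaqDeriv AveragingDeficitSideDeriv AveragingDeficitPeriodicCounting
open AveragingDeficitResidualPairing AveragingDeficitTorusChart

noncomputable section

variable {d : ℕ} {n : Type*} [Fintype n] [DecidableEq n]

local notation "𝕄" => Matrix n n ℂ
local notation "Site" => B7Prop1Explicit.Site

/-! ## §4 Smoothness of (42) in the chart parameter (the §8 chain of `T4AveragingDeficitWall`, multi-dimensional) -/

section Smooth

/-- `ψ ↦ chartDir ψ (x,κ)` is a continuous linear map, hence smooth. [folklore] -/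
theorem contDiff_chartDir_apply {m : WithTop ℕ∞} (P : 𝕄 →L[ℝ] 𝕄) (N : ℕ) [NeZero N] (x : Site d) (κ : Fin d) :
    ContDiff ℝ m (fun ψ : TDir d n N => chartDir P N ψ x κ) :=
  P.contDiff.comp (contDiff_apply_apply ℝ 𝕄 (redN N x) κ)

/-- `ψ ↦ chart ψ (x,κ) = V(x,κ) exp(P ψ(x mod N, κ))` is smooth. [folklore] -/
theorem contDiffAt_val_chart {m : WithTop ℕ∞} (P : 𝕄 →L[ℝ] 𝕄) (N : ℕ) [NeZero N] (V : Site d → Fin d → 𝕄ˣ) (x : Site d) (κ : Fin d) (ψ₀ : TDir d n N) :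
    ContDiffAt ℝ m (fun ψ : TDir d n N => ((chart P N V ψ x κ : 𝕄ˣ) : 𝕄)) ψ₀ := by
  simp only [chart, Units.val_mul, val_expUnit]
  exact contDiffAt_const.mul
    (((exp_analytic (𝕂 := ℝ) _).contDiffAt).comp ψ₀ (contDiff_chartDir_apply P N x κ).contDiffAt)

/-- `ψ ↦ (chart ψ (x,κ))⁻¹ = exp(−P ψ(x mod N, κ)) V(x,κ)⁻¹` is smooth. [folklore] -/
theorem contDiffAt_val_chart_inv {m : WithTop ℕ∞} (P : 𝕄 →L[ℝ] 𝕄) (N : ℕ) [NeZero N] (V : Site d → Fin d → 𝕄ˣ) (x : Site d) (κ : Fin d) (ψ₀ : TDir d n N) :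
    ContDiffAt ℝ m (fun ψ : TDir d n N => (((chart P N V ψ x κ)⁻¹ : 𝕄ˣ) : 𝕄)) ψ₀ := by
  simp only [chart, mul_inv_rev, Units.val_mul, val_inv_expUnit, val_expUnit]
  exact (((exp_analytic (𝕂 := ℝ) _).contDiffAt).comp ψ₀ (contDiff_chartDir_apply P N x κ).neg.contDiffAt).mul
    contDiffAt_const

/-- Each letter's bond variable is smooth in the chart parameter. [folklore] -/
theorem contDiffAt_val_stepHol_chart {m : WithTop ℕ∞} (P : 𝕄 →L[ℝ] 𝕄) (N : ℕ) [NeZero N] (V : Site d → Fin d → 𝕄ˣ) (x : Site d) (l : Letter d) (ψ₀ : TDir d n N) :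
    ContDiffAt ℝ m (fun ψ : TDir d n N => ((stepHol (chart P N V ψ) x l : 𝕄ˣ) : 𝕄)) ψ₀ := by
  obtain ⟨μ, b⟩ := l
  cases b
  · simp only [stepHol, Bool.false_eq_true, ↓reduceIte]
    exact contDiffAt_val_chart_inv P N V _ μ ψ₀
  · simp only [stepHol, ↓reduceIte]
    exact contDiffAt_val_chart P N V x μ ψ₀

/-- **Parallel transport (9) along any word is smooth in the chart parameter.** [folklore] -/
theorem contDiffAt_val_hol_chart {m : WithTop ℕ∞} (P : 𝕄 →L[ℝ] 𝕄) (N : ℕ) [NeZero N] (V : Site d → Fin d → 𝕄ˣ) (ψ₀ : TDir d n N) : ∀ (w : List (Letter d)) (x : Site d),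
    ContDiffAt ℝ m (fun ψ : TDir d n N => ((hol (chart P N V ψ) x w : 𝕄ˣ) : 𝕄)) ψ₀
  | [], x => by
      simp only [hol_nil, Units.val_one]
      exact contDiffAt_const
  | l :: w, x => by
      simp only [hol_cons, Units.val_mul]
      exact (contDiffAt_val_stepHol_chart P N V x l ψ₀).mul (contDiffAt_val_hol_chart P N V ψ₀ w _)

/-- The loop variable `V(Γ_{c,x})V(c)⁻¹` of (42) is smooth in the chart parameter. [folklore] -/
theorem contDiffAt_val_Wcx_chart {m : WithTop ℕ∞} (P : 𝕄 →L[ℝ] 𝕄) (N : ℕ) [NeZero N] (V : Site d → Fin d → 𝕄ˣ) (L : ℕ) (q : Site d) (κ : Fin d) (r : Site d) (ψ₀ : TDir d n N) :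
    ContDiffAt ℝ m (fun ψ : TDir d n N => ((Wcx L (chart P N V ψ) q κ r : 𝕄ˣ) : 𝕄)) ψ₀ := by
  simp only [Wcx_eq_hol_loop]
  exact contDiffAt_val_hol_chart P N V ψ₀ _ _

/-- `log` of the loop variable is smooth at parameters where it lies in the ball of (21). [folklore] -/
theorem contDiffAt_mlog_Wcx_chart {m : WithTop ℕ∞} (P : 𝕄 →L[ℝ] 𝕄) (N : ℕ) [NeZero N] (V : Site d → Fin d → 𝕄ˣ) (L : ℕ) (q : Site d) (κ : Fin d) (r : Site d) (ψ₀ : TDir d n N)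
    (hW : ‖((Wcx L (chart P N V ψ₀) q κ r : 𝕄ˣ) : 𝕄) - 1‖ < 1) :
    ContDiffAt ℝ m (fun ψ : TDir d n N => mlog ((Wcx L (chart P N V ψ) q κ r : 𝕄ˣ) : 𝕄)) ψ₀ := by
  have hg : ContDiffAt ℝ m (mlog : 𝕄 → 𝕄) ((Wcx L (chart P N V ψ₀) q κ r : 𝕄ˣ) : 𝕄) :=
    ((analyticAt_mlog hW).contDiffAt).restrict_scalars ℝ
  have h := hg.comp ψ₀ (contDiffAt_val_Wcx_chart P N V L q κ r ψ₀)
  exact h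

/-- The exponent `X_c` of (42) is smooth at parameters inside the ball. [folklore] -/
theorem contDiffAt_Xavg_chart {m : WithTop ℕ∞} (P : 𝕄 →L[ℝ] 𝕄) (N : ℕ) [NeZero N] (V : Site d → Fin d → 𝕄ˣ) (L : ℕ) (q : Site d) (κ : Fin d) (ψ₀ : TDir d n N)
    (hW : ∀ r : Fin d → Fin L, ‖((Wcx L (chart P N V ψ₀) q κ (boxVec L r) : 𝕄ˣ) : 𝕄) - 1‖ < 1) :
    ContDiffAt ℝ m (fun ψ : TDir d n N => Xavg L (chart P N V ψ) q κ) ψ₀ := by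
  unfold Xavg
  exact ContDiffAt.sum fun r _ => (contDiffAt_mlog_Wcx_chart P N V L q κ _ ψ₀ (hW r)).const_smul _

/-- **The averaged bond variable `V̄_c` (42) is smooth in the chart parameter** (inside the ball). [folklore] -/
theorem contDiffAt_val_bavg_chart {m : WithTop ℕ∞} (P : 𝕄 →L[ℝ] 𝕄) (N : ℕ) [NeZero N] (V : Site d → Fin d → 𝕄ˣ) (L : ℕ) (q : Site d) (κ : Fin d) (ψ₀ : TDir d n N)
    (hW : ∀ r : Fin d → Fin L, ‖((Wcx L (chart P N V ψ₀) q κ (boxVec L r) : 𝕄ˣ) : 𝕄) - 1‖ < 1) :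
    ContDiffAt ℝ m (fun ψ : TDir d n N => ((bavg L (chart P N V ψ) q κ : 𝕄ˣ) : 𝕄)) ψ₀ := by
  simp only [bavg, Units.val_mul, val_expUnit]
  exact (((exp_analytic (𝕂 := ℝ) _).contDiffAt).comp ψ₀ (contDiffAt_Xavg_chart P N V L q κ ψ₀ hW)).mul
    (contDiffAt_val_hol_chart P N V ψ₀ _ _)

/-- … and so is its inverse. [folklore] -/
theorem contDiffAt_val_bavg_inv_chart {m : WithTop ℕ∞} (P : 𝕄 →L[ℝ] 𝕄) (N : ℕ) [NeZero N] (V : Site d → Fin d → 𝕄ˣ) (L : ℕ) (q : Site d) (κ : Fin d) (ψ₀ : TDir d n N)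
    (hW : ∀ r : Fin d → Fin L, ‖((Wcx L (chart P N V ψ₀) q κ (boxVec L r) : 𝕄ˣ) : 𝕄) - 1‖ < 1) :
    ContDiffAt ℝ m (fun ψ : TDir d n N => (((bavg L (chart P N V ψ) q κ)⁻¹ : 𝕄ˣ) : 𝕄)) ψ₀ := by
  have h1 : ContDiffAt ℝ m (Ring.inverse : 𝕄 → 𝕄) ((bavg L (chart P N V ψ₀) q κ : 𝕄ˣ) : 𝕄) :=
    contDiffAt_ringInverse ℝ _
  refine (h1.comp ψ₀ (contDiffAt_val_bavg_chart P N V L q κ ψ₀ hW)).congr_of_eventuallyEq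
    (Filter.Eventually.of_forall fun ψ => ?_)
  simp only [Function.comp_apply, Ring.inverse_unit]

/-- **The fine Wilson action of a window is smooth in the chart parameter.** [folklore] -/
theorem contDiffAt_fineAction_chart {m : WithTop ℕ∞} (P : 𝕄 →L[ℝ] 𝕄) (N : ℕ) [NeZero N] (V : Site d → Fin d → 𝕄ˣ) (W : Finset (T4AveragingDeficitWall.Plaq d)) (ψ₀ : TDir d n N) :
    ContDiffAt ℝ m (fun ψ : TDir d n N => fineAction (chart P N V ψ) W) ψ₀ := by
  unfold fineAction
  refine ContDiffAt.sum fun p _ => ?_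
  have h1 := contDiffAt_val_hol_chart (m := m) P N V ψ₀ (plaqWord p.2.1.1 p.2.1.2) p.1
  have hL : ContDiffAt ℝ m (nReTrL : 𝕄 → ℝ) ((hol (chart P N V ψ₀) p.1 (plaqWord p.2.1.1 p.2.1.2) : 𝕄ˣ) : 𝕄) :=
    (nReTrL (n := n)).contDiff.contDiffAt
  have h2 := hL.comp ψ₀ h1
  have h3 : ContDiffAt ℝ m (fun ψ : TDir d n N =>
      (1 : ℝ) - nReTrL ((hol (chart P N V ψ) p.1 (plaqWord p.2.1.1 p.2.1.2) : 𝕄ˣ) : 𝕄)) ψ₀ :=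
    contDiffAt_const.sub h2
  refine h3.congr_of_eventuallyEq (Filter.Eventually.of_forall fun ψ => ?_)
  simp only [wt, fhol, nReTrL_apply]

end Smooth

/-! ## §5 Coordinates of the average on the coarse torus; `D log(1) = id`; the differential is `pushDir` -/

/-- The averaged configuration read on the COARSE UNIT LATTICE: `(cavg L U)(y,κ) = Ū(⟨Ly, Ly + Le_κ⟩)`. [cite: Balaban1985Averaging, (42) p.23] -/
def cavg (L : ℕ) (U : Site d → Fin d → 𝕄ˣ) : Site d → Fin d → 𝕄ˣ := fun y κ => bavg L U ((L : ℤ) • y) κ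

/-- Exponential-chart coordinates of a configuration `W` relative to `W₀` on the torus bonds: `log(W₀(b)⁻¹ W(b))`. [folklore] -/
def relLog (M : ℕ) (W₀ W : Site d → Fin d → 𝕄ˣ) : TDir d n M :=
  fun r κ => mlog ((((W₀ (boxVec M r) κ)⁻¹ : 𝕄ˣ) : 𝕄) * ((W (boxVec M r) κ : 𝕄ˣ) : 𝕄))

/-- THE COORDINATES OF THE AVERAGE OF THE CHART: `coord P L M V ψ = log((cavg V)(b)⁻¹ · (cavg (chart ψ))(b))` on the
bonds `b` of the coarse torus `[0,M)^d` (chart parameter on the fine torus `[0,LM)^d`). [folklore] -/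
def coord (P : 𝕄 →L[ℝ] 𝕄) (L M : ℕ) [NeZero (L * M)] (V : Site d → Fin d → 𝕄ˣ) (ψ : TDir d n (L * M)) :
    TDir d n M :=
  relLog M (cavg L V) (cavg L (chart P (L * M) V ψ))

/-- `log 1 = 0` for the series (21). [folklore] -/
theorem mlog_one : mlog (1 : 𝕄) = 0 := by
  have h := norm_mlog_le_two_mul (X := (1 : 𝕄)) (by rw [sub_self, norm_zero]; norm_num)
  rw [sub_self, norm_zero, mul_zero] at h
  exact norm_le_zero_iff.mp h

/-- `relLog W W = 0`. [folklore] -/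
@[simp] theorem relLog_self (M : ℕ) (W : Site d → Fin d → 𝕄ˣ) : relLog M W W = (0 : TDir d n M) := by
  funext r κ
  simp only [relLog, Units.inv_mul, mlog_one, Pi.zero_apply]

/-- `coord 0 = 0`. [folklore] -/
@[simp] theorem coord_zero (P : 𝕄 →L[ℝ] 𝕄) (L M : ℕ) [NeZero (L * M)] (V : Site d → Fin d → 𝕄ˣ) :
    coord P L M V 0 = 0 := by
  simp only [coord, chart_zero, relLog_self]

/-- **`D log(1) = id`**: the series (21) has the identity as its Fréchet derivative at `1` (from `exp ∘ log = id` on the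
ball, `exp_mlog`, and `D exp(0) = id`). [folklore] -/
theorem hasFDerivAt_mlog_one : HasFDerivAt (mlog : 𝕄 → 𝕄) (ContinuousLinearMap.id ℂ 𝕄) 1 := by
  have h0 : ‖(1 : 𝕄) - 1‖ < 1 := by rw [sub_self, norm_zero]; exact one_pos
  obtain ⟨D, hD⟩ : ∃ D : 𝕄 →L[ℂ] 𝕄, HasFDerivAt (mlog : 𝕄 → 𝕄) D 1 :=
    ⟨_, (analyticAt_mlog h0).differentiableAt.hasFDerivAt⟩
  have hexp : HasFDerivAt (exp : 𝕄 → 𝕄) (1 : 𝕄 →L[ℂ] 𝕄) (mlog (1 : 𝕄)) := by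
    rw [mlog_one]
    exact hasFDerivAt_exp_zero
  have hcomp : HasFDerivAt (fun X : 𝕄 => exp (mlog X)) ((1 : 𝕄 →L[ℂ] 𝕄).comp D) 1 := hexp.comp (1 : 𝕄) hD
  have hev : (fun X : 𝕄 => exp (mlog X)) =ᶠ[𝓝 (1 : 𝕄)] id := by
    have hb : ∀ᶠ X in 𝓝 (1 : 𝕄), ‖X - 1‖ < 1 := by
      have := Metric.ball_mem_nhds (1 : 𝕄) one_pos
      exact Filter.mem_of_superset this fun X hX => by simpa [dist_eq_norm] using hX
    exact hb.mono fun X hX => by simp only [id, exp_mlog hX]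
  have hid : HasFDerivAt (id : 𝕄 → 𝕄) ((1 : 𝕄 →L[ℂ] 𝕄).comp D) 1 := hcomp.congr_of_eventuallyEq hev.symm
  have huniq := (hasFDerivAt_id (1 : 𝕄)).unique hid
  have hDid : D = ContinuousLinearMap.id ℂ 𝕄 := by
    refine ContinuousLinearMap.ext fun X => ?_
    have := congrArg (fun T : 𝕄 →L[ℂ] 𝕄 => T X) huniq
    simpa using this.symm
  rw [← hDid]
  exact hD

/-- Directional derivatives from the Fréchet derivative: `d/ds|₀ Φ(sψ) = DΦ(0)ψ`. [folklore] -/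
theorem hasDerivAt_comp_smul {E F : Type*} [NormedAddCommGroup E] [NormedSpace ℝ E] [NormedAddCommGroup F]
    [NormedSpace ℝ F] {Φ : E → F} {Φ' : E →L[ℝ] F} (h : HasFDerivAt Φ Φ' 0) (ψ : E) :
    HasDerivAt (fun s : ℝ => Φ (s • ψ)) (Φ' ψ) 0 := by
  have hl : HasDerivAt (fun s : ℝ => s • ψ) ψ 0 := by
    simpa using (hasDerivAt_id (0 : ℝ)).smul_const ψ
  have h' : HasFDerivAt Φ Φ' ((fun s : ℝ => s • ψ) 0) := by
    rwa [show (fun s : ℝ => s • ψ) 0 = 0 from zero_smul ℝ ψ]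
  exact h'.comp_hasDerivAt (0 : ℝ) hl

/-- Inside the ball of (21) the coordinates of the average are smooth at `ψ = 0`. [folklore] -/
theorem contDiffAt_coord {m : WithTop ℕ∞} (P : 𝕄 →L[ℝ] 𝕄) (L M : ℕ) [NeZero (L * M)] (V : Site d → Fin d → 𝕄ˣ)
    (hW : ∀ (q : Site d) (κ : Fin d) (r : Fin d → Fin L), ‖((Wcx L V q κ (boxVec L r) : 𝕄ˣ) : 𝕄) - 1‖ < 1) :
    ContDiffAt ℝ m (coord P L M V) 0 := by
  rw [contDiffAt_pi]
  intro r
  rw [contDiffAt_pi]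
  intro κ
  have hin : ContDiffAt ℝ m (fun ψ : TDir d n (L * M) => (((cavg L V (boxVec M r) κ)⁻¹ : 𝕄ˣ) : 𝕄)
      * ((bavg L (chart P (L * M) V ψ) ((L : ℤ) • boxVec M r) κ : 𝕄ˣ) : 𝕄)) 0 :=
    contDiffAt_const.mul (contDiffAt_val_bavg_chart P (L * M) V L _ κ 0 (by rw [chart_zero]; exact hW _ _))
  have h1 : ‖(((cavg L V (boxVec M r) κ)⁻¹ : 𝕄ˣ) : 𝕄)
      * ((bavg L (chart P (L * M) V 0) ((L : ℤ) • boxVec M r) κ : 𝕄ˣ) : 𝕄) - 1‖ < 1 := by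
    rw [chart_zero, cavg, Units.inv_mul, sub_self, norm_zero]
    exact one_pos
  have hg : ContDiffAt ℝ m (mlog : 𝕄 → 𝕄) ((((cavg L V (boxVec M r) κ)⁻¹ : 𝕄ˣ) : 𝕄)
      * ((bavg L (chart P (L * M) V 0) ((L : ℤ) • boxVec M r) κ : 𝕄ˣ) : 𝕄)) :=
    ((analyticAt_mlog h1).contDiffAt).restrict_scalars ℝ
  have h := hg.comp 0 hin
  exact h

/-- **THE DIFFERENTIAL OF THE COORDINATES OF THE AVERAGE IS THE PUSH-FORWARD (gen 2's `pushDir`, BY NAME)**: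
`D coord(0) ψ (r,κ) = pushDir L V (chartDir ψ) (L·r, κ)` — the multi-dimensional form of the differential of (42)
(`hasDerivAt_val_bavg_vary`: `d/ds|₀ \overline{V e^{sφ}}(c) = δV̄(c)·V̄(c)`, and `D log(1) = id`).
[cite: Balaban1985Averaging, (42) p.23] -/
theorem fderiv_coord_apply (P : 𝕄 →L[ℝ] 𝕄) (L M : ℕ) [NeZero (L * M)] (V : Site d → Fin d → 𝕄ˣ)
    (hW : ∀ (q : Site d) (κ : Fin d) (r : Fin d → Fin L), ‖((Wcx L V q κ (boxVec L r) : 𝕄ˣ) : 𝕄) - 1‖ < 1)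
    (ψ : TDir d n (L * M)) (r : Fin d → Fin M) (κ : Fin d) :
    (fderiv ℝ (coord P L M V) 0) ψ r κ = pushDir L V (chartDir P (L * M) ψ) ((L : ℤ) • boxVec M r) κ := by
  have hF : HasFDerivAt (coord P L M V) (fderiv ℝ (coord P L M V) 0) 0 :=
    ((contDiffAt_coord (m := 1) P L M V hW).differentiableAt one_ne_zero).hasFDerivAt
  have h1 : HasDerivAt (fun s : ℝ => coord P L M V (s • ψ) r κ) ((fderiv ℝ (coord P L M V) 0) ψ r κ) 0 :=
    hasDerivAt_pi.mp (hasDerivAt_pi.mp (hasDerivAt_comp_smul hF ψ) r) κ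
  set q : Site d := (L : ℤ) • boxVec M r with hq
  have h2 : HasDerivAt (fun s : ℝ => coord P L M V (s • ψ) r κ) (pushDir L V (chartDir P (L * M) ψ) q κ) 0 := by
    simp only [coord, relLog, cavg, chart_smul, ← hq]
    have hb := (hasDerivAt_val_bavg_vary L V (chartDir P (L * M) ψ) q κ (hW q κ)).const_mul
      (((bavg L V q κ)⁻¹ : 𝕄ˣ) : 𝕄)
    have hval : (((bavg L V q κ)⁻¹ : 𝕄ˣ) : 𝕄) * ((bavg L (vary V (chartDir P (L * M) ψ) 0) q κ : 𝕄ˣ) : 𝕄) = 1 := by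
      rw [vary_zero, Units.inv_mul]
    have hm := (hasFDerivAt_mlog_one (n := n)).restrictScalars ℝ
    rw [← hval] at hm
    have hc := hm.comp_hasDerivAt (0 : ℝ) hb
    have hder : (ContinuousLinearMap.restrictScalars ℝ (ContinuousLinearMap.id ℂ 𝕄))
        ((((bavg L V q κ)⁻¹ : 𝕄ˣ) : 𝕄) * (sideDeriv L V (chartDir P (L * M) ψ) q κ * ((bavg L V q κ : 𝕄ˣ) : 𝕄)))
        = pushDir L V (chartDir P (L * M) ψ) q κ := by
      simp only [ContinuousLinearMap.coe_restrictScalars', ContinuousLinearMap.id_apply, pushDir, Ad, inv_inv, mul_assoc]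
    rw [hder] at hc
    exact hc
  exact h1.unique h2

/-- **THE DERIVATIVE OF THE FINE ACTION ALONG `vary V (chartDir ψ)` IS THE FRÉCHET DERIVATIVE OF THE CHART ACTION**
applied to `ψ`. [folklore] -/
theorem hasDerivAt_fineAction_chartDir (P : 𝕄 →L[ℝ] 𝕄) (N : ℕ) [NeZero N] (V : Site d → Fin d → 𝕄ˣ)
    (W : Finset (T4AveragingDeficitWall.Plaq d)) (ψ : TDir d n N) :
    HasDerivAt (fun s : ℝ => fineAction (vary V (chartDir P N ψ) s) W)
      ((fderiv ℝ (fun ψ' : TDir d n N => fineAction (chart P N V ψ') W) 0) ψ) 0 := by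
  have hF := ((contDiffAt_fineAction_chart (m := 1) P N V W 0).differentiableAt one_ne_zero).hasFDerivAt
  have h := hasDerivAt_comp_smul hF ψ
  simpa only [chart_smul] using h

end

end Summit.QuantumFields.BalabanUV.T4Continuum.AveragingDeficitChartCalculus
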